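import Summits.HubbardSuperconductivity.HubbardLadder.Su2WeightZeroReduction

/-!
# GroupAlgebraPieces — projector calculus transported from a finite group algebra ([C](b0), generic part)

HONEST FRAMING: ladder R1–R4 with certified numbers; no claim on H/H₀.  Cell pub-hubbard, lane r2 (g43); design INBOX l.5252.
Pure finite-dimensional linear algebra: for a monoid hom `U : G →* Matrix ι ι ℂ` from a finite group and rational coefficient
tables `α : G → ℚ`, the operators `algOp U α = Σ_g α(g) • U g` multiply by CONVOLUTION of the tables (`algOp_mul`), take adjoints
by INVERSION of the tables when `(U g)ᴴ = U g⁻¹` (`algOp_conjTranspose`), commute with every `X` commuting with all `U g`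
(`comm_algOp`), and `algOp U δ₁ = 1` (`algOp_delta_one`).  Hence identities among coefficient tables decided in `ℚ[G]` (a finite
computation) become the hypotheses `hherm` / `horth` / `hres` / `hcomm` of `ClusterCut.rayleigh_ge_of_pieces`.  All statements [folklore].

FILER NOTE (lit g35): author bytes `pub-hubbard-r2/clusterrow-g43/lean/GroupAlgebraPieces.lean` sha256 3a79915dae2f16cf… (r2 g43,
INBOX l.5254); this copy adds ONE docstring line on `conv_tableOfInt` (gate `lint.docstring`) and this note — every statement,
proof and definition byte unchanged.
-/

namespace Summit.HubbardSuperconductivity.HubbardLadder.ClusterCut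

open Matrix Complex Finset

variable {ι G : Type*} [Fintype ι] [DecidableEq ι] [Group G] [Fintype G]

/-- The operator `Σ_g α(g) • U g` attached to a coefficient table `α : G → ℚ`. [folklore] -/
noncomputable def algOp (U : G →* Matrix ι ι ℂ) (α : G → ℚ) : Matrix ι ι ℂ :=
  ∑ g, ((α g : ℚ) : ℂ) • U g

/-- Convolution of coefficient tables: `(α ⋆ β)(k) = Σ_g α(g) β(g⁻¹ k)`. [folklore] -/
def conv (α β : G → ℚ) : G → ℚ := fun k => ∑ g, α g * β (g⁻¹ * k)

/-- The table of the identity element. [folklore] -/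
def deltaOne [DecidableEq G] : G → ℚ := fun g => if g = 1 then 1 else 0

/-- **Products are convolutions**: `algOp U α * algOp U β = algOp U (α ⋆ β)`. [folklore] -/
theorem algOp_mul (U : G →* Matrix ι ι ℂ) (α β : G → ℚ) :
    algOp U α * algOp U β = algOp U (conv α β) := by
  unfold algOp conv
  rw [Finset.sum_mul_sum]
  simp only [Matrix.smul_mul, Matrix.mul_smul, smul_smul, ← map_mul, Rat.cast_sum, Rat.cast_mul, Finset.sum_smul]
  conv_rhs => rw [Finset.sum_comm]
  refine Finset.sum_congr rfl fun g _ => ?_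
  exact Fintype.sum_equiv (Equiv.mulLeft g) _ _ fun h => by simp [mul_comm]

/-- **Adjoints are inversions**: if `(U g)ᴴ = U g⁻¹` then `(algOp U α)ᴴ = algOp U (g ↦ α g⁻¹)`. [folklore] -/
theorem algOp_conjTranspose (U : G →* Matrix ι ι ℂ) (hU : ∀ g, (U g)ᴴ = U g⁻¹) (α : G → ℚ) :
    (algOp U α)ᴴ = algOp U (fun g => α g⁻¹) := by
  unfold algOp
  rw [Matrix.conjTranspose_sum]
  simp only [Matrix.conjTranspose_smul, hU, Complex.star_def, map_ratCast]
  exact Fintype.sum_equiv (Equiv.inv G) _ _ fun g => by simp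

/-- `algOp` of the identity table is `1`. [folklore] -/
theorem algOp_deltaOne [DecidableEq G] (U : G →* Matrix ι ι ℂ) : algOp U deltaOne = 1 := by
  unfold algOp deltaOne
  rw [Finset.sum_eq_single (1 : G)]
  · simp
  · intro g _ hg
    simp [hg]
  · intro h
    exact absurd (Finset.mem_univ _) h

/-- `algOp` is additive over finite families of tables. [folklore] -/
theorem algOp_finsum (U : G →* Matrix ι ι ℂ) {T : Type*} (s : Finset T) (α : T → G → ℚ) :
    algOp U (fun g => ∑ b ∈ s, α b g) = ∑ b ∈ s, algOp U (α b) := by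
  unfold algOp
  simp only [Rat.cast_sum, Finset.sum_smul]
  rw [Finset.sum_comm]

/-- The zero table gives `0`. [folklore] -/
theorem algOp_zero (U : G →* Matrix ι ι ℂ) : algOp U (fun _ => 0) = 0 := by
  simp [algOp]

/-- Anything commuting with every `U g` commutes with every `algOp U α`. [folklore] -/
theorem comm_algOp (U : G →* Matrix ι ι ℂ) {X : Matrix ι ι ℂ} (hX : ∀ g, X * U g = U g * X) (α : G → ℚ) :
    X * algOp U α = algOp U α * X := by
  unfold algOp
  rw [Finset.mul_sum, Finset.sum_mul]
  refine Finset.sum_congr rfl fun g _ => ?_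
  rw [Matrix.mul_smul, Matrix.smul_mul, hX]

/-- **Pieces from tables.**  If the coefficient tables `α b` (`b ∈ T`) are convolution-idempotent and -orthogonal, sum to `δ₁`, and are
inversion-invariant (all decided in `ℚ[G]`), and `U` is a unitary-type representation (`(U g)ᴴ = U g⁻¹`) whose image commutes with
`X`, then the operators `P b = algOp U (α b)` satisfy the four hypothesis families of `rayleigh_ge_of_pieces`
(Hermitian, pairwise orthogonal, commuting with `X`, resolving every vector). [folklore] -/
theorem pieces_of_tables [DecidableEq G] (U : G →* Matrix ι ι ℂ) (hU : ∀ g, (U g)ᴴ = U g⁻¹) {T : Type*} [Fintype T]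
    [DecidableEq T]
    (α : T → G → ℚ) (hconv : ∀ b b', conv (α b) (α b') = if b = b' then α b else fun _ => 0)
    (hsum : (fun g => ∑ b, α b g) = deltaOne) (hinv : ∀ b g, α b g⁻¹ = α b g)
    {X : Matrix ι ι ℂ} (hX : ∀ g, X * U g = U g * X) :
    (∀ b, (algOp U (α b))ᴴ = algOp U (α b)) ∧
    (∀ b b', b ≠ b' → algOp U (α b) * algOp U (α b') = 0) ∧
    (∀ b, X * algOp U (α b) = algOp U (α b) * X) ∧
    (∀ v : ι → ℂ, ∑ b, algOp U (α b) *ᵥ v = v) := by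
  refine ⟨fun b => ?_, fun b b' hbb' => ?_, fun b => comm_algOp U hX (α b), fun v => ?_⟩
  · rw [algOp_conjTranspose U hU]
    congr 1
    funext g
    exact hinv b g
  · rw [algOp_mul, hconv, if_neg hbb', algOp_zero]
  · rw [← Matrix.sum_mulVec, ← algOp_finsum, hsum, algOp_deltaOne, Matrix.one_mulVec]

/-! ## Integer tables with a common denominator (so that the `ℚ[G]` identities are `decide`d over `ℤ`) -/

/-- The rational table `a / N` of an integer table `a`. [folklore] -/
def tableOfInt (N : ℕ) (a : G → ℤ) : G → ℚ := fun g => (a g : ℚ) / N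

/-- Integer convolution `(a ⋆ a')(k) = Σ_g a(g) a'(g⁻¹ k)`. [folklore] -/
def convInt (a a' : G → ℤ) : G → ℤ := fun k => ∑ g, a g * a' (g⁻¹ * k)

omit [Fintype ι] [DecidableEq ι] in
/-- Convolution of two integer tables read over a common denominator `N`: `(a/N) ⋆ (a'/N) = (a ⋆ a')/N²`. [folklore] -/
theorem conv_tableOfInt (N : ℕ) (a a' : G → ℤ) :
    conv (tableOfInt N a) (tableOfInt N a') = fun k => (convInt a a' k : ℚ) / ((N : ℚ) * N) := by
  funext k
  simp only [conv, tableOfInt, convInt, Int.cast_sum, Int.cast_mul, Finset.sum_div]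
  refine Finset.sum_congr rfl fun g _ => ?_
  ring

/-- **Pieces from integer tables.**  With a common denominator `N ≠ 0`: if `a b ⋆ a b' = N·δ_{bb'}·(a b)`, `Σ_b a b = N·δ₁` and
`a b (g⁻¹) = a b g` (three finite integer identities, `decide`-able for a concrete finite group), then the operators
`P b = algOp U (a b / N) = (1/N) Σ_g a b g • U g` satisfy the hypotheses of `rayleigh_ge_of_pieces`. [folklore] -/
theorem pieces_of_intTables [DecidableEq G] (U : G →* Matrix ι ι ℂ) (hU : ∀ g, (U g)ᴴ = U g⁻¹) {T : Type*} [Fintype T]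
    [DecidableEq T] (N : ℕ) (hN : N ≠ 0) (a : T → G → ℤ)
    (hconv : ∀ b b', convInt (a b) (a b') = if b = b' then (fun k => (N : ℤ) * a b k) else fun _ => 0)
    (hsum : (fun g => ∑ b, a b g) = fun g => if g = 1 then (N : ℤ) else 0) (hinv : ∀ b g, a b g⁻¹ = a b g)
    {X : Matrix ι ι ℂ} (hX : ∀ g, X * U g = U g * X) :
    (∀ b, (algOp U (tableOfInt N (a b)))ᴴ = algOp U (tableOfInt N (a b))) ∧
    (∀ b b', b ≠ b' → algOp U (tableOfInt N (a b)) * algOp U (tableOfInt N (a b')) = 0) ∧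
    (∀ b, X * algOp U (tableOfInt N (a b)) = algOp U (tableOfInt N (a b)) * X) ∧
    (∀ v : ι → ℂ, ∑ b, algOp U (tableOfInt N (a b)) *ᵥ v = v) := by
  have hNq : (N : ℚ) ≠ 0 := Nat.cast_ne_zero.mpr hN
  refine pieces_of_tables U hU (fun b => tableOfInt N (a b)) (fun b b' => ?_) ?_ (fun b g => ?_) hX
  · rw [conv_tableOfInt, hconv b b']
    split_ifs with h
    · subst h
      funext k
      simp only [tableOfInt, Int.cast_mul, Int.cast_natCast]
      field_simp
    · funext k
      simp
  · funext g
    have := congrFun hsum g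
    simp only [tableOfInt, deltaOne, ← Finset.sum_div]
    rw [← Int.cast_sum, this]
    split_ifs <;> simp [hNq]
  · simp only [tableOfInt, hinv]

/-! ## The oct12 symmetry group `D₄ × Z₂` (lattice point group × spin flip) and its twelve piece tables

Species `b : Fin 12`: `0..7` = (χ, f) with χ ∈ {A₁, A₂, B₁, B₂} the one-dimensional characters of `D₄` (in this order, two flip
signs `f = +, −` each: index `2·χ + f`), table `a (g, ε) = χ(g) · f^ε`; `8..11` = the E-pieces `(1 − z)/2 · (1 + σ m)/2 · (1 + f F)/2`
with `z = r 2`, `m = sr 0`, `σ, f ∈ {+, −}` (index `8 + 2·σ + f`), table supported on `{1, m, z, zm} × Z₂` with values `±2`.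
Common denominator `N = 16`.  The three identities are decided by the kernel. -/

/-- The symmetry group of the oct12 cluster row: `D₄` (lattice) × `Z₂` (global spin flip). -/
abbrev Oct12Sym : Type := DihedralGroup 4 × Multiplicative (ZMod 2)

/-- Sign `(-1)^ε` of the flip component for flip-parity `f` (`f = 0` ↦ even, `f = 1` ↦ odd). -/
def flipSign (f : Fin 2) (ε : Multiplicative (ZMod 2)) : ℤ :=
  if f = 0 then 1 else (if Multiplicative.toAdd ε = 0 then 1 else -1)

/-- The four one-dimensional characters of `D₄`: index 0 = A₁, 1 = A₂, 2 = B₁, 3 = B₂. -/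
def d4Char (c : Fin 4) : DihedralGroup 4 → ℤ
  | DihedralGroup.r i => if c.val < 2 then 1 else (if i.val % 2 = 0 then 1 else -1)
  | DihedralGroup.sr i =>
      (if c = 0 ∨ c = 2 then 1 else -1) * (if c.val < 2 then 1 else (if i.val % 2 = 0 then 1 else -1))

/-- The E-piece table `2·(1 − z)(1 + σ m)` on `D₄` (`z = r 2`, `m = sr 0`; `σ = 0` ↦ `+`, `σ = 1` ↦ `−`). -/
def eTab (σ : Fin 2) : DihedralGroup 4 → ℤ
  | DihedralGroup.r i => if i = 0 then 2 else (if i = 2 then -2 else 0)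
  | DihedralGroup.sr i => (if σ = 0 then 1 else -1) * (if i = 0 then 2 else (if i = 2 then -2 else 0))

/-- The twelve integer piece tables on `D₄ × Z₂` (denominator 16). -/
def oct12Table (b : Fin 12) (g : Oct12Sym) : ℤ :=
  if h : b.val < 8 then d4Char ⟨b.val / 2, by omega⟩ g.1 * flipSign ⟨b.val % 2, by omega⟩ g.2
  else eTab ⟨(b.val - 8) / 2, by omega⟩ g.1 * flipSign ⟨b.val % 2, by omega⟩ g.2

/-- Convolution identities `a_b ⋆ a_b' = 16·δ_{bb'}·a_b` in `ℤ[D₄ × Z₂]`, decided by the kernel. -/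
theorem oct12Table_conv : ∀ b b' : Fin 12,
    convInt (oct12Table b) (oct12Table b') = if b = b' then (fun k => (16 : ℤ) * oct12Table b k) else fun _ => 0 := by
  decide +kernel

/-- Completeness `Σ_b a_b = 16·δ₁` in `ℤ[D₄ × Z₂]`, decided by the kernel. -/
theorem oct12Table_sum :
    (fun g : Oct12Sym => ∑ b, oct12Table b g) = fun g => if g = 1 then ((16 : ℕ) : ℤ) else 0 := by
  decide +kernel

/-- Inversion invariance `a_b (g⁻¹) = a_b g`, decided by the kernel. -/
theorem oct12Table_inv : ∀ (b : Fin 12) (g : Oct12Sym), oct12Table b g⁻¹ = oct12Table b g := by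
  decide +kernel

/-- **The twelve oct12 pieces.**  For any unitary-type representation `U` of `D₄ × Z₂` (`(U g)ᴴ = U g⁻¹`) whose image commutes
with `X`, the operators `P b = (1/16) Σ_g oct12Table b g • U g` are Hermitian, pairwise orthogonal, commute with `X` and resolve
every vector — i.e. the hypotheses `hherm`/`horth`/`hcomm`/`hres` of `rayleigh_ge_of_pieces`. [folklore] -/
theorem oct12_pieces (U : Oct12Sym →* Matrix ι ι ℂ) (hU : ∀ g, (U g)ᴴ = U g⁻¹)
    {X : Matrix ι ι ℂ} (hX : ∀ g, X * U g = U g * X) :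
    (∀ b, (algOp U (tableOfInt 16 (oct12Table b)))ᴴ = algOp U (tableOfInt 16 (oct12Table b))) ∧
    (∀ b b', b ≠ b' → algOp U (tableOfInt 16 (oct12Table b)) * algOp U (tableOfInt 16 (oct12Table b')) = 0) ∧
    (∀ b, X * algOp U (tableOfInt 16 (oct12Table b)) = algOp U (tableOfInt 16 (oct12Table b)) * X) ∧
    (∀ v : ι → ℂ, ∑ b, algOp U (tableOfInt 16 (oct12Table b)) *ᵥ v = v) :=
  pieces_of_intTables U hU 16 (by norm_num) oct12Table oct12Table_conv oct12Table_sum oct12Table_inv hX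

end Summit.HubbardSuperconductivity.HubbardLadder.ClusterCut
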